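import Summits.CriticalPhenomena.CardyFormulaZ2.Theorems.CardyBoundaryCoulombGasBoundaryDefectGaussianRStubRigidityOfLocalLawsPart8
import Summits.CriticalPhenomena.CardyFormulaZ2.Theorems.CardyBoundaryCoulombGasBoundaryDefectGaussianRStubRigidityOfLocalLawsPart3

/-!
# Stub `stub_rigidity_of_local_laws` of line `rainbow-monomials-in-excursion-kernels` — Part 9:
# the skeleton-v2-shaped conditional theorem

Crux `BoundaryDefectGaussianR` (stmt-CriticalPhenomena-14132). `s3_rigidityOfTransportV2`:

  `TRANSPORT → HOLEFREE → REAL → POINT_TRANSPORT → CLV2 → RIGIDITY`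

with TRANSPORT, REAL the texts of Part 4 (`s3_rigidityOfTransport`; files `TRANSPORT.txt`,
`REAL.txt` of the worker folder), POINT_TRANSPORT and RIGIDITY the registered texts of
`stub_pointTransport` and of the conclusion of `stub_rigidity_of_local_laws` (unchanged), CLV2 the
corrected cluster-locality text (the registered one with the four connectivity hypotheses —
`V` lattice-connected, `ℤ² ∖ V` king-connected, same for `V′` — inserted after `1 ≤ m →`; file
`CLV2.txt`), and HOLEFREE the statement that the lattice approximations of a rectilinear Jordan
domain eventually have these two properties (file `HOLEFREE.txt`). Proof: `s3_rigidityAbstractV2`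
(Part 8) instantiated by definitional unfolding, the two connectivity predicates being
`C1 W := ∀ u ∈ W, ∀ w ∈ W, ReflTransGen (lattice step in W) u w` and
`C2 W := ∀ u ∉ W, ∀ w ∉ W, ReflTransGen (king step off W) u w`.

Also here (registered sub-goal `s3_dsucc_kingStep`): consecutive vertices of the boundary walk
`dsucc` of `CollarLegModel` are king-adjacent (Part 3's `s3_dsucc_iterate_dist` at one step).
-/

noncomputable section

open Filter Topology

namespace Summit.CriticalPhenomena.CardyFormulaZ2.Cruxes.BoundaryDefectGaussianR.RainbowMonomialsInExcursionKernels

/-- **Rigidity from the local laws, conditional form, V2 (skeleton-v2-shaped).**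
`TRANSPORT → HOLEFREE → REAL → POINT_TRANSPORT → CLV2 → RIGIDITY`. [folklore] -/
theorem s3_rigidityOfTransportV2 :
    (∀ (k : ℕ) (L : Fin k → ℕ) (j : Fin k), L j = ∑ i ∈ Finset.univ.erase j, L i → ∀ (D :
    Literature.Probability.RandomPlanarGeometry.MarkedDomain k), (∃ S : Finset (ℂ × ℂ), (∀ q ∈ S, q.1.re =
    q.2.re ∨ q.1.im = q.2.im) ∧ frontier D.carrier ⊆ ⋃ q ∈ S, segment ℝ q.1 q.2) → (∀ i, (∃ r : ℝ, 0 < r ∧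
    ((∀ z ∈ frontier D.carrier, dist z (D.pt i) < r → z.im = (D.pt i).im) ∨ (∀ z ∈ frontier D.carrier, dist
    z (D.pt i) < r → z.re = (D.pt i).re)))) → (∃ τ : ℂ, ‖τ‖ = 1 ∧ (∃ ε : ℝ, 0 < ε ∧ ∀ t ∈ Set.Ioo (D.mark j)
    (D.mark j + ε), ∃ s : ℝ, 0 < s ∧ D.boundary t = D.pt j + (s : ℂ) * τ) ∧ (∃ ε : ℝ, 0 < ε ∧ ∀ s ∈ Set.Ioo
    (0 : ℝ) ε, D.pt j + (s : ℂ) * (τ * Complex.I) ∈ D.carrier)) → ∀ (δ : ℕ → ℝ), (∀ n, 0 < δ n) →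
    Filter.Tendsto δ Filter.atTop (nhds 0) → ∀ (V : ℕ → Finset (ℤ × ℤ)), (∀ n, ∀ v : ℤ × ℤ, v ∈ V n ↔
    (((v).1 : ℂ) * ((δ n : ℝ) : ℂ) + ((v).2 : ℂ) * ((δ n : ℝ) : ℂ) * Complex.I) ∈ closure D.carrier) → ∀ (p
    : ℕ → Fin k → ℤ × ℤ), (∀ n, Function.Injective ((p) n)) → (∀ i, Filter.Tendsto (fun n ↦ ((((p) n i).1 :
    ℂ) * ((δ n : ℝ) : ℂ) + (((p) n i).2 : ℂ) * ((δ n : ℝ) : ℂ) * Complex.I)) Filter.atTop (nhds (D.pt i))) →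
    (∀ n, Literature.Probability.LatticeModels.CollarLegModel.LegInsertionData.IsAdmissible
    (⟨(Finset.univ.erase j).image ((p) n), fun v ↦ ∑ b ∈ (Finset.univ.erase j).filter (fun b ↦ ((p) n) b =
    v), L b, ((p) n) j⟩ : Literature.Probability.LatticeModels.CollarLegModel.LegInsertionData) (V n)) → ∃
    (a : ℕ → ℤ × ℤ) (s₀ r₀ : ℝ) (N : ℕ), 0 < s₀ ∧ 0 < r₀ ∧ (∀ᶠ n in Filter.atTop, ∀ v : ℤ × ℤ, (((((v).1 -
    (a n).1) ^ 2 + ((v).2 - (a n).2) ^ 2 : ℤ) : ℝ)) ≤ (s₀ / δ n) ^ 2 → (v ∈ V n ↔ 0 ≤ v.2 - (a n).2)) ∧ ∀ (r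
    : ℝ), 0 < r → r ≤ r₀ → ∀ (ρ : ℝ), 0 < ρ → ρ ≤ r → ∀ᶠ n in Filter.atTop, ∀ (x : Fin k → ℤ), StrictMono x
    → (∀ i₁ i₂ : Fin k, i₁ ≠ i₂ → (r / δ n) ^ 2 ≤ (((x i₁ - x i₂) ^ 2 : ℤ) : ℝ)) → (∀ i, (((x i) ^ 2 : ℤ) :
    ℝ) ≤ (s₀ / δ n) ^ 2) → ∃ (T : ℕ) (q : ℕ → Fin k → ℤ × ℤ) (σ : ℕ → Bool), q 0 = p n ∧ (q T = fun i ↦ ((a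
    n).1 + x i, (a n).2)) ∧ (T : ℝ) * δ n ≤ N ∧ ((Finset.range T).filter (fun t ↦ σ t = false)).card ≤ N ∧
    (∀ t, t ≤ T → Function.Injective (q t) ∧
    Literature.Probability.LatticeModels.CollarLegModel.LegInsertionData.IsAdmissible (⟨(Finset.univ.erase
    j).image (q t), fun v ↦ ∑ b ∈ (Finset.univ.erase j).filter (fun b ↦ (q t) b = v), L b, (q t) j⟩ :
    Literature.Probability.LatticeModels.CollarLegModel.LegInsertionData) (V n) ∧ (∀ i, (∃ d : ℤ × ℤ, (d =
    (1, 0) ∨ d = (-1, 0) ∨ d = (0, 1) ∨ d = (0, -1)) ∧ ∀ v : ℤ × ℤ, (((((v).1 - (q t i).1) ^ 2 + ((v).2 - (q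
    t i).2) ^ 2 : ℤ) : ℝ)) ≤ (ρ / 4 / δ n) ^ 2 → (v ∈ V n ↔ 0 ≤ (v.1 - (q t i).1) * d.1 + (v.2 - (q t i).2)
    * d.2))) ∧ (∀ i₁ i₂ : Fin k, i₁ ≠ i₂ → (r / δ n) ^ 2 ≤ ((((((q t) i₁).1 - ((q t) i₂).1) ^ 2 + (((q t)
    i₁).2 - ((q t) i₂).2) ^ 2 : ℤ) : ℝ)))) ∧ (∀ t, t < T → (σ t = true → ∃ (i : Fin k) (τ : ℤ × ℤ), (τ = (1,
    0) ∨ τ = (-1, 0) ∨ τ = (0, 1) ∨ τ = (0, -1)) ∧ q (t + 1) = Function.update (q t) i (q t i + τ)) ∧ (σ t =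
    false → ∃ (i : Fin k) (q' : ℤ × ℤ), q (t + 1) = Function.update (q t) i q' ∧ (∀ i', i' ≠ i → (∃ d : ℤ ×
    ℤ, (d = (1, 0) ∨ d = (-1, 0) ∨ d = (0, 1) ∨ d = (0, -1)) ∧ ∀ v : ℤ × ℤ, (((((v).1 - (q t i').1) ^ 2 +
    ((v).2 - (q t i').2) ^ 2 : ℤ) : ℝ)) ≤ (r / δ n) ^ 2 → (v ∈ V n ↔ 0 ≤ (v.1 - (q t i').1) * d.1 + (v.2 -
    (q t i').2) * d.2))) ∧ (((((q').1 - (q t i).1) ^ 2 + ((q').2 - (q t i).2) ^ 2 : ℤ) : ℝ)) ≤ (ρ / δ n) ^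
    2))) → (∀ (D : Literature.Probability.RandomPlanarGeometry.JordanDomain), (∃ S : Finset (ℂ × ℂ), (∀ q ∈
    S, q.1.re = q.2.re ∨ q.1.im = q.2.im) ∧ frontier D.carrier ⊆ ⋃ q ∈ S, segment ℝ q.1 q.2) → ∀ (δ : ℕ →
    ℝ), (∀ n, 0 < δ n) → Filter.Tendsto δ Filter.atTop (nhds 0) → ∀ (V : ℕ → Finset (ℤ × ℤ)), (∀ n, ∀ v : ℤ
    × ℤ, v ∈ V n ↔ (((v).1 : ℂ) * ((δ n : ℝ) : ℂ) + ((v).2 : ℂ) * ((δ n : ℝ) : ℂ) * Complex.I) ∈ closure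
    D.carrier) → ∀ᶠ n in Filter.atTop, (∀ u ∈ V n, ∀ w ∈ V n, Relation.ReflTransGen (fun b c : ℤ × ℤ ↦ b ∈ V
    n ∧ c ∈ V n ∧ (b.1 - c.1) ^ 2 + (b.2 - c.2) ^ 2 = 1) u w) ∧ (∀ u ∉ V n, ∀ w ∉ V n, Relation.ReflTransGen
    (fun b c : ℤ × ℤ ↦ b ∉ V n ∧ c ∉ V n ∧ max |b.1 - c.1| |b.2 - c.2| ≤ 1) u w)) → (∀ (k : ℕ) (L : Fin k →
    ℕ) (j : Fin k), L j = ∑ i ∈ Finset.univ.erase j, L i → ∀ (D :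
    Literature.Probability.RandomPlanarGeometry.JordanDomain), (∃ S : Finset (ℂ × ℂ), (∀ q ∈ S, q.1.re =
    q.2.re ∨ q.1.im = q.2.im) ∧ frontier D.carrier ⊆ ⋃ q ∈ S, segment ℝ q.1 q.2) → ∀ (r : ℝ), 0 < r → ∀ (δ :
    ℕ → ℝ), (∀ n, 0 < δ n) → Filter.Tendsto δ Filter.atTop (nhds 0) → ∀ (V : ℕ → Finset (ℤ × ℤ)), (∀ n, ∀ v
    : ℤ × ℤ, v ∈ V n ↔ (((v).1 : ℂ) * ((δ n : ℝ) : ℂ) + ((v).2 : ℂ) * ((δ n : ℝ) : ℂ) * Complex.I) ∈ closure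
    D.carrier) → ∀ᶠ n in Filter.atTop, ∀ (p : Fin k → ℤ × ℤ), Function.Injective p →
    Literature.Probability.LatticeModels.CollarLegModel.LegInsertionData.IsAdmissible (⟨(Finset.univ.erase
    j).image (p), fun v ↦ ∑ b ∈ (Finset.univ.erase j).filter (fun b ↦ (p) b = v), L b, (p) j⟩ :
    Literature.Probability.LatticeModels.CollarLegModel.LegInsertionData) (V n) → (∀ i', (∃ d : ℤ × ℤ, (d =
    (1, 0) ∨ d = (-1, 0) ∨ d = (0, 1) ∨ d = (0, -1)) ∧ ∀ v : ℤ × ℤ, (((((v).1 - (p i').1) ^ 2 + ((v).2 - (p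
    i').2) ^ 2 : ℤ) : ℝ)) ≤ (r / δ n) ^ 2 → (v ∈ V n ↔ 0 ≤ (v.1 - (p i').1) * d.1 + (v.2 - (p i').2) *
    d.2))) → (∀ i₁ i₂ : Fin k, i₁ ≠ i₂ → (r / δ n) ^ 2 ≤ ((((((p) i₁).1 - ((p) i₂).1) ^ 2 + (((p) i₁).2 -
    ((p) i₂).2) ^ 2 : ℤ) : ℝ))) → 0 < (‖Literature.Probability.LatticeModels.CollarLegModel.Zins (V n)
    (⟨(Finset.univ.erase j).image (p), fun v ↦ ∑ b ∈ (Finset.univ.erase j).filter (fun b ↦ (p) b = v), L b,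
    (p) j⟩ : Literature.Probability.LatticeModels.CollarLegModel.LegInsertionData)‖ /
    ‖(Literature.Probability.LatticeModels.CollarLegModel.ofDomain (V n)).Z‖)) → (∀ (k : ℕ) (L : Fin k → ℕ)
    (j : Fin k), L j = ∑ i ∈ Finset.univ.erase j, L i → (∀ (D :
    Literature.Probability.RandomPlanarGeometry.JordanDomain), (∃ S : Finset (ℂ × ℂ), (∀ q ∈ S, q.1.re =
    q.2.re ∨ q.1.im = q.2.im) ∧ frontier D.carrier ⊆ ⋃ q ∈ S, segment ℝ q.1 q.2) → ∀ (r ε : ℝ), 0 < r → 0 <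
    ε → ∀ (δ : ℕ → ℝ), (∀ n, 0 < δ n) → Filter.Tendsto δ Filter.atTop (nhds 0) → ∀ (V : ℕ → Finset (ℤ × ℤ)),
    (∀ n, ∀ v : ℤ × ℤ, v ∈ V n ↔ (((v).1 : ℂ) * ((δ n : ℝ) : ℂ) + ((v).2 : ℂ) * ((δ n : ℝ) : ℂ) * Complex.I)
    ∈ closure D.carrier) → ∀ᶠ n in Filter.atTop, ∀ (p : Fin k → ℤ × ℤ) (i : Fin k) (τ : ℤ × ℤ), (τ = (1, 0)
    ∨ τ = (-1, 0) ∨ τ = (0, 1) ∨ τ = (0, -1)) → Function.Injective p → Function.Injective (Function.update p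
    i (p i + τ)) → Literature.Probability.LatticeModels.CollarLegModel.LegInsertionData.IsAdmissible
    (⟨(Finset.univ.erase j).image (p), fun v ↦ ∑ b ∈ (Finset.univ.erase j).filter (fun b ↦ (p) b = v), L b,
    (p) j⟩ : Literature.Probability.LatticeModels.CollarLegModel.LegInsertionData) (V n) →
    Literature.Probability.LatticeModels.CollarLegModel.LegInsertionData.IsAdmissible (⟨(Finset.univ.erase
    j).image ((Function.update p i (p i + τ))), fun v ↦ ∑ b ∈ (Finset.univ.erase j).filter (fun b ↦
    ((Function.update p i (p i + τ))) b = v), L b, ((Function.update p i (p i + τ))) j⟩ :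
    Literature.Probability.LatticeModels.CollarLegModel.LegInsertionData) (V n) → 0 <
    (‖Literature.Probability.LatticeModels.CollarLegModel.Zins (V n) (⟨(Finset.univ.erase j).image (p), fun
    v ↦ ∑ b ∈ (Finset.univ.erase j).filter (fun b ↦ (p) b = v), L b, (p) j⟩ :
    Literature.Probability.LatticeModels.CollarLegModel.LegInsertionData)‖ /
    ‖(Literature.Probability.LatticeModels.CollarLegModel.ofDomain (V n)).Z‖) → 0 <
    (‖Literature.Probability.LatticeModels.CollarLegModel.Zins (V n) (⟨(Finset.univ.erase j).image
    ((Function.update p i (p i + τ))), fun v ↦ ∑ b ∈ (Finset.univ.erase j).filter (fun b ↦ ((Function.update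
    p i (p i + τ))) b = v), L b, ((Function.update p i (p i + τ))) j⟩ :
    Literature.Probability.LatticeModels.CollarLegModel.LegInsertionData)‖ /
    ‖(Literature.Probability.LatticeModels.CollarLegModel.ofDomain (V n)).Z‖) → (∀ i', (∃ d : ℤ × ℤ, (d =
    (1, 0) ∨ d = (-1, 0) ∨ d = (0, 1) ∨ d = (0, -1)) ∧ ∀ v : ℤ × ℤ, (((((v).1 - (p i').1) ^ 2 + ((v).2 - (p
    i').2) ^ 2 : ℤ) : ℝ)) ≤ (r / δ n) ^ 2 → (v ∈ V n ↔ 0 ≤ (v.1 - (p i').1) * d.1 + (v.2 - (p i').2) *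
    d.2))) → (∀ i₁ i₂ : Fin k, i₁ ≠ i₂ → (r / δ n) ^ 2 ≤ ((((((p) i₁).1 - ((p) i₂).1) ^ 2 + (((p) i₁).2 -
    ((p) i₂).2) ^ 2 : ℤ) : ℝ))) → |(Real.log (‖Literature.Probability.LatticeModels.CollarLegModel.Zins (V
    n) (⟨(Finset.univ.erase j).image ((Function.update p i (p i + τ))), fun v ↦ ∑ b ∈ (Finset.univ.erase
    j).filter (fun b ↦ ((Function.update p i (p i + τ))) b = v), L b, ((Function.update p i (p i + τ))) j⟩ :
    Literature.Probability.LatticeModels.CollarLegModel.LegInsertionData)‖ /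
    ‖(Literature.Probability.LatticeModels.CollarLegModel.ofDomain (V n)).Z‖) - (∑ i₁ : Fin k, ∑ i₂ ∈
    Finset.univ.filter (fun i₂ : Fin k ↦ i₁ < i₂), (-((if i₁ = j then (1 - (L j : ℝ)) else (L i₁ : ℝ)) * (if
    i₂ = j then (1 - (L j : ℝ)) else (L i₂ : ℝ))) / 6) * Real.log
    (Literature.Probability.LatticeModels.dirichletGreen ((V n).image (fun v : ℤ × ℤ ↦ (![v.1, v.2] : Fin 2
    → ℤ))) (![(((Function.update p i (p i + τ))) i₁).1, (((Function.update p i (p i + τ))) i₁).2] : Fin 2 →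
    ℤ) (![(((Function.update p i (p i + τ))) i₂).1, (((Function.update p i (p i + τ))) i₂).2] : Fin 2 →
    ℤ)))) - (Real.log (‖Literature.Probability.LatticeModels.CollarLegModel.Zins (V n) (⟨(Finset.univ.erase
    j).image (p), fun v ↦ ∑ b ∈ (Finset.univ.erase j).filter (fun b ↦ (p) b = v), L b, (p) j⟩ :
    Literature.Probability.LatticeModels.CollarLegModel.LegInsertionData)‖ /
    ‖(Literature.Probability.LatticeModels.CollarLegModel.ofDomain (V n)).Z‖) - (∑ i₁ : Fin k, ∑ i₂ ∈
    Finset.univ.filter (fun i₂ : Fin k ↦ i₁ < i₂), (-((if i₁ = j then (1 - (L j : ℝ)) else (L i₁ : ℝ)) * (if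
    i₂ = j then (1 - (L j : ℝ)) else (L i₂ : ℝ))) / 6) * Real.log
    (Literature.Probability.LatticeModels.dirichletGreen ((V n).image (fun v : ℤ × ℤ ↦ (![v.1, v.2] : Fin 2
    → ℤ))) (![((p) i₁).1, ((p) i₁).2] : Fin 2 → ℤ) (![((p) i₂).1, ((p) i₂).2] : Fin 2 → ℤ))))| ≤ ε * δ n) ∧
    (∀ (D : Literature.Probability.RandomPlanarGeometry.JordanDomain), (∃ S : Finset (ℂ × ℂ), (∀ q ∈ S,
    q.1.re = q.2.re ∨ q.1.im = q.2.im) ∧ frontier D.carrier ⊆ ⋃ q ∈ S, segment ℝ q.1 q.2) → ∀ (r ε : ℝ), 0 <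
    r → 0 < ε → ∃ ρ : ℝ, 0 < ρ ∧ ρ ≤ r ∧ ∀ (δ : ℕ → ℝ), (∀ n, 0 < δ n) → Filter.Tendsto δ Filter.atTop (nhds
    0) → ∀ (V : ℕ → Finset (ℤ × ℤ)), (∀ n, ∀ v : ℤ × ℤ, v ∈ V n ↔ (((v).1 : ℂ) * ((δ n : ℝ) : ℂ) + ((v).2 :
    ℂ) * ((δ n : ℝ) : ℂ) * Complex.I) ∈ closure D.carrier) → ∀ᶠ n in Filter.atTop, ∀ (p : Fin k → ℤ × ℤ) (i
    : Fin k) (q : ℤ × ℤ), Function.Injective p → Function.Injective (Function.update p i q) →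
    Literature.Probability.LatticeModels.CollarLegModel.LegInsertionData.IsAdmissible (⟨(Finset.univ.erase
    j).image (p), fun v ↦ ∑ b ∈ (Finset.univ.erase j).filter (fun b ↦ (p) b = v), L b, (p) j⟩ :
    Literature.Probability.LatticeModels.CollarLegModel.LegInsertionData) (V n) →
    Literature.Probability.LatticeModels.CollarLegModel.LegInsertionData.IsAdmissible (⟨(Finset.univ.erase
    j).image ((Function.update p i q)), fun v ↦ ∑ b ∈ (Finset.univ.erase j).filter (fun b ↦
    ((Function.update p i q)) b = v), L b, ((Function.update p i q)) j⟩ :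
    Literature.Probability.LatticeModels.CollarLegModel.LegInsertionData) (V n) → 0 <
    (‖Literature.Probability.LatticeModels.CollarLegModel.Zins (V n) (⟨(Finset.univ.erase j).image (p), fun
    v ↦ ∑ b ∈ (Finset.univ.erase j).filter (fun b ↦ (p) b = v), L b, (p) j⟩ :
    Literature.Probability.LatticeModels.CollarLegModel.LegInsertionData)‖ /
    ‖(Literature.Probability.LatticeModels.CollarLegModel.ofDomain (V n)).Z‖) → 0 <
    (‖Literature.Probability.LatticeModels.CollarLegModel.Zins (V n) (⟨(Finset.univ.erase j).image
    ((Function.update p i q)), fun v ↦ ∑ b ∈ (Finset.univ.erase j).filter (fun b ↦ ((Function.update p i q))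
    b = v), L b, ((Function.update p i q)) j⟩ :
    Literature.Probability.LatticeModels.CollarLegModel.LegInsertionData)‖ /
    ‖(Literature.Probability.LatticeModels.CollarLegModel.ofDomain (V n)).Z‖) → (∀ i', i' ≠ i → (∃ d : ℤ ×
    ℤ, (d = (1, 0) ∨ d = (-1, 0) ∨ d = (0, 1) ∨ d = (0, -1)) ∧ ∀ v : ℤ × ℤ, (((((v).1 - (p i').1) ^ 2 +
    ((v).2 - (p i').2) ^ 2 : ℤ) : ℝ)) ≤ (r / δ n) ^ 2 → (v ∈ V n ↔ 0 ≤ (v.1 - (p i').1) * d.1 + (v.2 - (p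
    i').2) * d.2))) → (∃ d : ℤ × ℤ, (d = (1, 0) ∨ d = (-1, 0) ∨ d = (0, 1) ∨ d = (0, -1)) ∧ ∀ v : ℤ × ℤ,
    (((((v).1 - (p i).1) ^ 2 + ((v).2 - (p i).2) ^ 2 : ℤ) : ℝ)) ≤ (ρ / 4 / δ n) ^ 2 → (v ∈ V n ↔ 0 ≤ (v.1 -
    (p i).1) * d.1 + (v.2 - (p i).2) * d.2)) → (∃ d : ℤ × ℤ, (d = (1, 0) ∨ d = (-1, 0) ∨ d = (0, 1) ∨ d =
    (0, -1)) ∧ ∀ v : ℤ × ℤ, (((((v).1 - (q).1) ^ 2 + ((v).2 - (q).2) ^ 2 : ℤ) : ℝ)) ≤ (ρ / 4 / δ n) ^ 2 → (v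
    ∈ V n ↔ 0 ≤ (v.1 - (q).1) * d.1 + (v.2 - (q).2) * d.2)) → (∀ i₁ i₂ : Fin k, i₁ ≠ i₂ → (r / δ n) ^ 2 ≤
    ((((((p) i₁).1 - ((p) i₂).1) ^ 2 + (((p) i₁).2 - ((p) i₂).2) ^ 2 : ℤ) : ℝ))) → (∀ i₁ i₂ : Fin k, i₁ ≠ i₂
    → (r / δ n) ^ 2 ≤ (((((((Function.update p i q)) i₁).1 - (((Function.update p i q)) i₂).1) ^ 2 +
    ((((Function.update p i q)) i₁).2 - (((Function.update p i q)) i₂).2) ^ 2 : ℤ) : ℝ))) → (((((q).1 - (p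
    i).1) ^ 2 + ((q).2 - (p i).2) ^ 2 : ℤ) : ℝ)) ≤ (ρ / δ n) ^ 2 → |(Real.log
    (‖Literature.Probability.LatticeModels.CollarLegModel.Zins (V n) (⟨(Finset.univ.erase j).image
    ((Function.update p i q)), fun v ↦ ∑ b ∈ (Finset.univ.erase j).filter (fun b ↦ ((Function.update p i q))
    b = v), L b, ((Function.update p i q)) j⟩ :
    Literature.Probability.LatticeModels.CollarLegModel.LegInsertionData)‖ /
    ‖(Literature.Probability.LatticeModels.CollarLegModel.ofDomain (V n)).Z‖) - (∑ i₁ : Fin k, ∑ i₂ ∈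
    Finset.univ.filter (fun i₂ : Fin k ↦ i₁ < i₂), (-((if i₁ = j then (1 - (L j : ℝ)) else (L i₁ : ℝ)) * (if
    i₂ = j then (1 - (L j : ℝ)) else (L i₂ : ℝ))) / 6) * Real.log
    (Literature.Probability.LatticeModels.dirichletGreen ((V n).image (fun v : ℤ × ℤ ↦ (![v.1, v.2] : Fin 2
    → ℤ))) (![(((Function.update p i q)) i₁).1, (((Function.update p i q)) i₁).2] : Fin 2 → ℤ)
    (![(((Function.update p i q)) i₂).1, (((Function.update p i q)) i₂).2] : Fin 2 → ℤ)))) - (Real.log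
    (‖Literature.Probability.LatticeModels.CollarLegModel.Zins (V n) (⟨(Finset.univ.erase j).image (p), fun
    v ↦ ∑ b ∈ (Finset.univ.erase j).filter (fun b ↦ (p) b = v), L b, (p) j⟩ :
    Literature.Probability.LatticeModels.CollarLegModel.LegInsertionData)‖ /
    ‖(Literature.Probability.LatticeModels.CollarLegModel.ofDomain (V n)).Z‖) - (∑ i₁ : Fin k, ∑ i₂ ∈
    Finset.univ.filter (fun i₂ : Fin k ↦ i₁ < i₂), (-((if i₁ = j then (1 - (L j : ℝ)) else (L i₁ : ℝ)) * (if
    i₂ = j then (1 - (L j : ℝ)) else (L i₂ : ℝ))) / 6) * Real.log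
    (Literature.Probability.LatticeModels.dirichletGreen ((V n).image (fun v : ℤ × ℤ ↦ (![v.1, v.2] : Fin 2
    → ℤ))) (![((p) i₁).1, ((p) i₁).2] : Fin 2 → ℤ) (![((p) i₂).1, ((p) i₂).2] : Fin 2 → ℤ))))| ≤ ε)) → (∀ (k
    : ℕ) (L : Fin k → ℕ) (j : Fin k), L j = ∑ i ∈ Finset.univ.erase j, L i → ∀ ε : ℝ, 0 < ε → ∃ M : ℝ, 0 < M
    ∧ ∀ (V V' : Finset (ℤ × ℤ)) (a a' : ℤ × ℤ) (m : ℝ), 1 ≤ m → (∀ u ∈ V, ∀ w ∈ V, Relation.ReflTransGen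
    (fun b c : ℤ × ℤ ↦ b ∈ V ∧ c ∈ V ∧ (b.1 - c.1) ^ 2 + (b.2 - c.2) ^ 2 = 1) u w) → (∀ u ∉ V, ∀ w ∉ V,
    Relation.ReflTransGen (fun b c : ℤ × ℤ ↦ b ∉ V ∧ c ∉ V ∧ max |b.1 - c.1| |b.2 - c.2| ≤ 1) u w) → (∀ u ∈
    V', ∀ w ∈ V', Relation.ReflTransGen (fun b c : ℤ × ℤ ↦ b ∈ V' ∧ c ∈ V' ∧ (b.1 - c.1) ^ 2 + (b.2 - c.2) ^
    2 = 1) u w) → (∀ u ∉ V', ∀ w ∉ V', Relation.ReflTransGen (fun b c : ℤ × ℤ ↦ b ∉ V' ∧ c ∉ V' ∧ max |b.1 -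
    c.1| |b.2 - c.2| ≤ 1) u w) → (∀ v : ℤ × ℤ, ((((v.1 - a.1) ^ 2 + (v.2 - a.2) ^ 2 : ℤ) : ℝ)) ≤ (M * m) ^ 2
    → (v ∈ V ↔ 0 ≤ v.2 - a.2)) → (∀ v : ℤ × ℤ, ((((v.1 - a'.1) ^ 2 + (v.2 - a'.2) ^ 2 : ℤ) : ℝ)) ≤ (M * m) ^
    2 → (v ∈ V' ↔ 0 ≤ v.2 - a'.2)) → ∀ (p : Fin k → ℤ × ℤ), Function.Injective p → (∀ i, (((((p i).1 - a.1)
    ^ 2 + ((p i).2 - a.2) ^ 2 : ℤ) : ℝ)) ≤ m ^ 2) →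
    Literature.Probability.LatticeModels.CollarLegModel.LegInsertionData.IsAdmissible (⟨(Finset.univ.erase
    j).image p, fun v ↦ ∑ b ∈ (Finset.univ.erase j).filter (fun b ↦ p b = v), L b, p j⟩ :
    Literature.Probability.LatticeModels.CollarLegModel.LegInsertionData) V →
    Literature.Probability.LatticeModels.CollarLegModel.LegInsertionData.IsAdmissible (⟨(Finset.univ.erase
    j).image (fun i ↦ p i - a + a'), fun v ↦ ∑ b ∈ (Finset.univ.erase j).filter (fun b ↦ (fun i ↦ p i - a +
    a') b = v), L b, (fun i ↦ p i - a + a') j⟩ :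
    Literature.Probability.LatticeModels.CollarLegModel.LegInsertionData) V' → 0 <
    (‖Literature.Probability.LatticeModels.CollarLegModel.Zins V (⟨(Finset.univ.erase j).image p, fun v ↦ ∑
    b ∈ (Finset.univ.erase j).filter (fun b ↦ p b = v), L b, p j⟩ :
    Literature.Probability.LatticeModels.CollarLegModel.LegInsertionData)‖ /
    ‖(Literature.Probability.LatticeModels.CollarLegModel.ofDomain V).Z‖) → 0 <
    (‖Literature.Probability.LatticeModels.CollarLegModel.Zins V' (⟨(Finset.univ.erase j).image (fun i ↦ p i
    - a + a'), fun v ↦ ∑ b ∈ (Finset.univ.erase j).filter (fun b ↦ (fun i ↦ p i - a + a') b = v), L b, (fun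
    i ↦ p i - a + a') j⟩ : Literature.Probability.LatticeModels.CollarLegModel.LegInsertionData)‖ /
    ‖(Literature.Probability.LatticeModels.CollarLegModel.ofDomain V').Z‖) → |(Real.log
    (‖Literature.Probability.LatticeModels.CollarLegModel.Zins V (⟨(Finset.univ.erase j).image p, fun v ↦ ∑
    b ∈ (Finset.univ.erase j).filter (fun b ↦ p b = v), L b, p j⟩ :
    Literature.Probability.LatticeModels.CollarLegModel.LegInsertionData)‖ /
    ‖(Literature.Probability.LatticeModels.CollarLegModel.ofDomain V).Z‖) - (∑ i₁ : Fin k, ∑ i₂ ∈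
    Finset.univ.filter (fun i₂ : Fin k ↦ i₁ < i₂), (-((if i₁ = j then (1 - (L j : ℝ)) else (L i₁ : ℝ)) * (if
    i₂ = j then (1 - (L j : ℝ)) else (L i₂ : ℝ))) / 6) * Real.log
    (Literature.Probability.LatticeModels.dirichletGreen (V.image (fun v : ℤ × ℤ ↦ (![v.1, v.2] : Fin 2 →
    ℤ))) (![(p i₁).1, (p i₁).2] : Fin 2 → ℤ) (![(p i₂).1, (p i₂).2] : Fin 2 → ℤ)))) - (Real.log
    (‖Literature.Probability.LatticeModels.CollarLegModel.Zins V' (⟨(Finset.univ.erase j).image (fun i ↦ p i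
    - a + a'), fun v ↦ ∑ b ∈ (Finset.univ.erase j).filter (fun b ↦ (fun i ↦ p i - a + a') b = v), L b, (fun
    i ↦ p i - a + a') j⟩ : Literature.Probability.LatticeModels.CollarLegModel.LegInsertionData)‖ /
    ‖(Literature.Probability.LatticeModels.CollarLegModel.ofDomain V').Z‖) - (∑ i₁ : Fin k, ∑ i₂ ∈
    Finset.univ.filter (fun i₂ : Fin k ↦ i₁ < i₂), (-((if i₁ = j then (1 - (L j : ℝ)) else (L i₁ : ℝ)) * (if
    i₂ = j then (1 - (L j : ℝ)) else (L i₂ : ℝ))) / 6) * Real.log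
    (Literature.Probability.LatticeModels.dirichletGreen (V'.image (fun v : ℤ × ℤ ↦ (![v.1, v.2] : Fin 2 →
    ℤ))) (![((fun i ↦ p i - a + a') i₁).1, ((fun i ↦ p i - a + a') i₁).2] : Fin 2 → ℤ) (![((fun i ↦ p i - a
    + a') i₂).1, ((fun i ↦ p i - a + a') i₂).2] : Fin 2 → ℤ))))| ≤ ε) → ∀ (k : ℕ) (L : Fin k → ℕ) (j : Fin
    k), L j = ∑ i ∈ Finset.univ.erase j, L i → ∀ (D D' :
    Literature.Probability.RandomPlanarGeometry.MarkedDomain k), (∃ S : Finset (ℂ × ℂ), (∀ q ∈ S, q.1.re =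
    q.2.re ∨ q.1.im = q.2.im) ∧ frontier D.carrier ⊆ ⋃ q ∈ S, segment ℝ q.1 q.2) → (∀ i, (∃ r : ℝ, 0 < r ∧
    ((∀ z ∈ frontier D.carrier, dist z (D.pt i) < r → z.im = (D.pt i).im) ∨ (∀ z ∈ frontier D.carrier, dist
    z (D.pt i) < r → z.re = (D.pt i).re)))) → (∃ τ : ℂ, ‖τ‖ = 1 ∧ (∃ ε : ℝ, 0 < ε ∧ ∀ t ∈ Set.Ioo (D.mark j)
    (D.mark j + ε), ∃ s : ℝ, 0 < s ∧ D.boundary t = D.pt j + (s : ℂ) * τ) ∧ (∃ ε : ℝ, 0 < ε ∧ ∀ s ∈ Set.Ioo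
    (0 : ℝ) ε, D.pt j + (s : ℂ) * (τ * Complex.I) ∈ D.carrier)) → (∃ S : Finset (ℂ × ℂ), (∀ q ∈ S, q.1.re =
    q.2.re ∨ q.1.im = q.2.im) ∧ frontier D'.carrier ⊆ ⋃ q ∈ S, segment ℝ q.1 q.2) → (∀ i, (∃ r : ℝ, 0 < r ∧
    ((∀ z ∈ frontier D'.carrier, dist z (D'.pt i) < r → z.im = (D'.pt i).im) ∨ (∀ z ∈ frontier D'.carrier,
    dist z (D'.pt i) < r → z.re = (D'.pt i).re)))) → (∃ τ : ℂ, ‖τ‖ = 1 ∧ (∃ ε : ℝ, 0 < ε ∧ ∀ t ∈ Set.Ioo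
    (D'.mark j) (D'.mark j + ε), ∃ s : ℝ, 0 < s ∧ D'.boundary t = D'.pt j + (s : ℂ) * τ) ∧ (∃ ε : ℝ, 0 < ε ∧
    ∀ s ∈ Set.Ioo (0 : ℝ) ε, D'.pt j + (s : ℂ) * (τ * Complex.I) ∈ D'.carrier)) → ∀ (δ : ℕ → ℝ), (∀ n, 0 < δ
    n) → Filter.Tendsto δ Filter.atTop (nhds 0) → ∀ (V V' : ℕ → Finset (ℤ × ℤ)), (∀ n, ∀ v : ℤ × ℤ, v ∈ V n
    ↔ (((v).1 : ℂ) * ((δ n : ℝ) : ℂ) + ((v).2 : ℂ) * ((δ n : ℝ) : ℂ) * Complex.I) ∈ closure D.carrier) → (∀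
    n, ∀ v : ℤ × ℤ, v ∈ V' n ↔ (((v).1 : ℂ) * ((δ n : ℝ) : ℂ) + ((v).2 : ℂ) * ((δ n : ℝ) : ℂ) * Complex.I) ∈
    closure D'.carrier) → ∀ (p p' : ℕ → Fin k → ℤ × ℤ), (∀ n, Function.Injective ((p) n)) → (∀ n,
    Function.Injective ((p') n)) → (∀ i, Filter.Tendsto (fun n ↦ ((((p) n i).1 : ℂ) * ((δ n : ℝ) : ℂ) +
    (((p) n i).2 : ℂ) * ((δ n : ℝ) : ℂ) * Complex.I)) Filter.atTop (nhds (D.pt i))) → (∀ i, Filter.Tendsto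
    (fun n ↦ ((((p') n i).1 : ℂ) * ((δ n : ℝ) : ℂ) + (((p') n i).2 : ℂ) * ((δ n : ℝ) : ℂ) * Complex.I))
    Filter.atTop (nhds (D'.pt i))) → (∀ n,
    Literature.Probability.LatticeModels.CollarLegModel.LegInsertionData.IsAdmissible (⟨(Finset.univ.erase
    j).image ((p) n), fun v ↦ ∑ b ∈ (Finset.univ.erase j).filter (fun b ↦ ((p) n) b = v), L b, ((p) n) j⟩ :
    Literature.Probability.LatticeModels.CollarLegModel.LegInsertionData) (V n)) → (∀ n,
    Literature.Probability.LatticeModels.CollarLegModel.LegInsertionData.IsAdmissible (⟨(Finset.univ.erase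
    j).image ((p') n), fun v ↦ ∑ b ∈ (Finset.univ.erase j).filter (fun b ↦ ((p') n) b = v), L b, ((p') n) j⟩
    : Literature.Probability.LatticeModels.CollarLegModel.LegInsertionData) (V' n)) → (∀ᶠ n in Filter.atTop,
    0 < (‖Literature.Probability.LatticeModels.CollarLegModel.Zins (V n) (⟨(Finset.univ.erase j).image (p
    n), fun v ↦ ∑ b ∈ (Finset.univ.erase j).filter (fun b ↦ (p n) b = v), L b, (p n) j⟩ :
    Literature.Probability.LatticeModels.CollarLegModel.LegInsertionData)‖ /
    ‖(Literature.Probability.LatticeModels.CollarLegModel.ofDomain (V n)).Z‖)) ∧ Filter.Tendsto (fun n ↦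
    (Real.log (‖Literature.Probability.LatticeModels.CollarLegModel.Zins (V n) (⟨(Finset.univ.erase j).image
    (p n), fun v ↦ ∑ b ∈ (Finset.univ.erase j).filter (fun b ↦ (p n) b = v), L b, (p n) j⟩ :
    Literature.Probability.LatticeModels.CollarLegModel.LegInsertionData)‖ /
    ‖(Literature.Probability.LatticeModels.CollarLegModel.ofDomain (V n)).Z‖) - (∑ i₁ : Fin k, ∑ i₂ ∈
    Finset.univ.filter (fun i₂ : Fin k ↦ i₁ < i₂), (-((if i₁ = j then (1 - (L j : ℝ)) else (L i₁ : ℝ)) * (if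
    i₂ = j then (1 - (L j : ℝ)) else (L i₂ : ℝ))) / 6) * Real.log
    (Literature.Probability.LatticeModels.dirichletGreen ((V n).image (fun v : ℤ × ℤ ↦ (![v.1, v.2] : Fin 2
    → ℤ))) (![((p n) i₁).1, ((p n) i₁).2] : Fin 2 → ℤ) (![((p n) i₂).1, ((p n) i₂).2] : Fin 2 → ℤ)))) -
    (Real.log (‖Literature.Probability.LatticeModels.CollarLegModel.Zins (V' n) (⟨(Finset.univ.erase
    j).image (p' n), fun v ↦ ∑ b ∈ (Finset.univ.erase j).filter (fun b ↦ (p' n) b = v), L b, (p' n) j⟩ :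
    Literature.Probability.LatticeModels.CollarLegModel.LegInsertionData)‖ /
    ‖(Literature.Probability.LatticeModels.CollarLegModel.ofDomain (V' n)).Z‖) - (∑ i₁ : Fin k, ∑ i₂ ∈
    Finset.univ.filter (fun i₂ : Fin k ↦ i₁ < i₂), (-((if i₁ = j then (1 - (L j : ℝ)) else (L i₁ : ℝ)) * (if
    i₂ = j then (1 - (L j : ℝ)) else (L i₂ : ℝ))) / 6) * Real.log
    (Literature.Probability.LatticeModels.dirichletGreen ((V' n).image (fun v : ℤ × ℤ ↦ (![v.1, v.2] : Fin 2
    → ℤ))) (![((p' n) i₁).1, ((p' n) i₁).2] : Fin 2 → ℤ) (![((p' n) i₂).1, ((p' n) i₂).2] : Fin 2 → ℤ)))))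
    Filter.atTop (nhds 0) := by
  intro hT hHF hR hPT hCL k L j hL
  exact s3_rigidityAbstractV2
    (fun (W : Finset (ℤ × ℤ)) (c : Fin k → ℤ × ℤ) ↦
    Literature.Probability.LatticeModels.CollarLegModel.LegInsertionData.IsAdmissible (⟨(Finset.univ.erase
    j).image (c), fun v ↦ ∑ b ∈ (Finset.univ.erase j).filter (fun b ↦ (c) b = v), L b, (c) j⟩ :
    Literature.Probability.LatticeModels.CollarLegModel.LegInsertionData) (W))
    (fun (W : Finset (ℤ × ℤ)) (c : Fin k → ℤ × ℤ) ↦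
    (‖Literature.Probability.LatticeModels.CollarLegModel.Zins (W) (⟨(Finset.univ.erase j).image (c), fun v
    ↦ ∑ b ∈ (Finset.univ.erase j).filter (fun b ↦ (c) b = v), L b, (c) j⟩ :
    Literature.Probability.LatticeModels.CollarLegModel.LegInsertionData)‖ /
    ‖(Literature.Probability.LatticeModels.CollarLegModel.ofDomain (W)).Z‖))
    (fun (W : Finset (ℤ × ℤ)) (c : Fin k → ℤ × ℤ) ↦ (Real.log
    (‖Literature.Probability.LatticeModels.CollarLegModel.Zins (W) (⟨(Finset.univ.erase j).image (c), fun v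
    ↦ ∑ b ∈ (Finset.univ.erase j).filter (fun b ↦ (c) b = v), L b, (c) j⟩ :
    Literature.Probability.LatticeModels.CollarLegModel.LegInsertionData)‖ /
    ‖(Literature.Probability.LatticeModels.CollarLegModel.ofDomain (W)).Z‖) - (∑ i₁ : Fin k, ∑ i₂ ∈
    Finset.univ.filter (fun i₂ : Fin k ↦ i₁ < i₂), (-((if i₁ = j then (1 - (L j : ℝ)) else (L i₁ : ℝ)) * (if
    i₂ = j then (1 - (L j : ℝ)) else (L i₂ : ℝ))) / 6) * Real.log
    (Literature.Probability.LatticeModels.dirichletGreen ((W).image (fun v : ℤ × ℤ ↦ (![v.1, v.2] : Fin 2 →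
    ℤ))) (![((c) i₁).1, ((c) i₁).2] : Fin 2 → ℤ) (![((c) i₂).1, ((c) i₂).2] : Fin 2 → ℤ)))))
    (fun (D : Literature.Probability.RandomPlanarGeometry.JordanDomain) ↦ ∃ S : Finset (ℂ × ℂ), (∀ q ∈ S,
    q.1.re = q.2.re ∨ q.1.im = q.2.im) ∧ frontier D.carrier ⊆ ⋃ q ∈ S, segment ℝ q.1 q.2)
    (fun (D : Literature.Probability.RandomPlanarGeometry.MarkedDomain k) ↦ ∀ i, (∃ r : ℝ, 0 < r ∧ ((∀ z ∈
    frontier D.carrier, dist z (D.pt i) < r → z.im = (D.pt i).im) ∨ (∀ z ∈ frontier D.carrier, dist z (D.pt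
    i) < r → z.re = (D.pt i).re))))
    (fun (D : Literature.Probability.RandomPlanarGeometry.MarkedDomain k) ↦ ∃ τ : ℂ, ‖τ‖ = 1 ∧ (∃ ε : ℝ, 0 <
    ε ∧ ∀ t ∈ Set.Ioo (D.mark j) (D.mark j + ε), ∃ s : ℝ, 0 < s ∧ D.boundary t = D.pt j + (s : ℂ) * τ) ∧ (∃
    ε : ℝ, 0 < ε ∧ ∀ s ∈ Set.Ioo (0 : ℝ) ε, D.pt j + (s : ℂ) * (τ * Complex.I) ∈ D.carrier))
    (fun (D : Literature.Probability.RandomPlanarGeometry.JordanDomain) (δ : ℕ → ℝ) (V : ℕ → Finset (ℤ × ℤ))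
    ↦ ∀ n, ∀ v : ℤ × ℤ, v ∈ V n ↔ (((v).1 : ℂ) * ((δ n : ℝ) : ℂ) + ((v).2 : ℂ) * ((δ n : ℝ) : ℂ) *
    Complex.I) ∈ closure D.carrier)
    (fun (D : Literature.Probability.RandomPlanarGeometry.MarkedDomain k) (δ : ℕ → ℝ) (p : ℕ → Fin k → ℤ ×
    ℤ) ↦ ∀ i, Filter.Tendsto (fun n ↦ ((((p) n i).1 : ℂ) * ((δ n : ℝ) : ℂ) + (((p) n i).2 : ℂ) * ((δ n : ℝ)
    : ℂ) * Complex.I)) Filter.atTop (nhds (D.pt i)))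
    (fun (W : Finset (ℤ × ℤ)) ↦ ∀ u ∈ W, ∀ w ∈ W, Relation.ReflTransGen (fun b c : ℤ × ℤ ↦ b ∈ W ∧ c ∈ W ∧
    (b.1 - c.1) ^ 2 + (b.2 - c.2) ^ 2 = 1) u w)
    (fun (W : Finset (ℤ × ℤ)) ↦ ∀ u ∉ W, ∀ w ∉ W, Relation.ReflTransGen (fun b c : ℤ × ℤ ↦ b ∉ W ∧ c ∉ W ∧
    max |b.1 - c.1| |b.2 - c.2| ≤ 1) u w)
    (hT k L j hL) hHF (hR k L j hL) (hPT k L j hL) (hCL k L j hL)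

open Literature.Probability.LatticeModels Literature.Probability.LatticeModels.CollarLegModel in
/-- **Consecutive boundary-walk vertices are king-adjacent**: one step of `dsucc V` moves the
vertex by at most one unit in each coordinate. [folklore] -/
theorem s3_dsucc_kingStep :
    ∀ (V : Finset (ℤ × ℤ)) (d : Literature.Probability.LatticeModels.CollarLegModel.Dart),
    max |(Literature.Probability.LatticeModels.CollarLegModel.dsucc V d).1.1 - d.1.1|
      |(Literature.Probability.LatticeModels.CollarLegModel.dsucc V d).1.2 - d.1.2| ≤ 1 := by
  intro V d
  have h := s3_dsucc_iterate_dist V d 1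
  simp only [Function.iterate_one, Nat.cast_one] at h
  exact max_le h.1 h.2

end Summit.CriticalPhenomena.CardyFormulaZ2.Cruxes.BoundaryDefectGaussianR.RainbowMonomialsInExcursionKernels

end
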